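import Summits.QuantumFields.BalabanUV.Beta.GAN24.CombExitFaceCurrentDivFree
import Summits.QuantumFields.BalabanUV.Beta.GAN24.CombSpureSlotCharges
import Summits.QuantumFields.BalabanUV.Beta.GAN24.ExitFaceCurrentCellTotalsStep
import Summits.QuantumFields.BalabanUV.Beta.CombFormSlotGaugeLetter

/-!
# `BalabanUV.Beta.GAN24.CombExitFaceCurrentCellTotals` — binder row G-an2-4 ∕ (CONV-C), W-slot CT-W, the COMB chart (III′): HYPOTHESIS (Z)_comb OF (24)_comb AT LEVELS
# `j + 1 ≥ 1` DISCHARGED AT THE WARD PINS — **THE BOND-RESUMMED EXIT-FACE CURRENT OF THE TRANSPORTED COMB CUBIC SECTOR HAS ZERO CELL TOTALS**, hence (with my K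
# `CombExitFaceCurrentDivFree`, (D)_comb unconditional) **(24)_comb(j+1) HOLDS UNCONDITIONALLY at the pins `(cE, cVH) = (Lc^{d+1}, −½Lc^{2(d+1)})`** (`Odd Lc`, `3 ≤ Lc`, every `d`,
# every `j`, every `cΛt cΛ`, all units `s_f s_m`)

NOT IN PRINT; OUR BOOKKEEPING ([folklore] BY NAME: an2 g39's comb cubic Ward letter `CombFormSlotGaugeLetter.divV_e3OfK_SrecOf_GcombSh_inl_inl` (constant `½`, the SAME value Hessian
`E2 d Lc (j+1)` as the spine — `CombChartContactFactor.mmRead_GcombSh`) with (V-d) traded for an1's (S-V)⁰⁴ `SymAveragingWardRootedStencils.divV_symVhSAt_eq_conjV_ctr` by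
`DshAn1.hVd_iff`; Road-P2 M.43 `CombCubicStepTransport.e3OfK_GcombSh_eq_bm_transport` (`e3OfK Lc (GcombSh Lc j) S = e3OfK Lc G_j (𝒯 S)`); leaf-06 g52's Abel resummation
`CubicGaugeLetterLinearGrowth.tsum_grad_mul_eq_tsum_mul_divV` and sawtooth `ExitFaceHalfVertexSplit.sawtooth_grad ∕ abs_sawtooth_le`; leaf-04 g68's generic cell-total theorem
`ExitFaceCurrentCellTotals.sum_box_faceSlot_current_eq_zero` and its member-free value-Hessian hypotheses `ExitFaceCurrentCellTotalsStep.summable_abs_E2_row ∕ tsum_E2_mul_face_eq_zero ∕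
sum_box_E2_face_sawtooth_eq_zero`; this lineage's K `CombExitFaceCurrentDivFree.comb_vhE_word_succ_eq_zero_of_cellTotals` ((24)_comb(j+1) ⟸ (Z)_comb) and P2
`CombSpureSlotCharges.hasSum_slot_leg'_unitS_SpureCombOf_succ` («S3C-REC» (iii) at the comb); an2's `ValueJetGeneric.e3OfK_translate`, `CombVHEWordsZeroStep.transport_ScombOf_translate ∕
exists_locStencil_transport_ScombOf`; G-an2-4 formalisation swarm, leaf prover `b2b-balaban-gan24-formalise-leaf-01`, gen 87, file R).
HONEST FRAMING (cell contract, verbatim): «discharging `BetaPertH` makes Bałaban's UV stability UNCONDITIONAL — a real constructive-QFT result; it is NOT the continuum limit and NOT the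
Clay problem.»  HONEST DEPENDENCY (verbatim): «continuum YM on T⁴ ⇐ BetaPertH ∧ nine spine estimates (0/9 proved); BetaPertH ⇐ (D1) ∧ (D4) ∧ CAP+tail; G-an2-4 gates asym, D1 and NE2/3/4.»

WHAT ([folklore]; generic `d`, `[NeZero Lc]`, comb root `ctr (d+1) Lc`, THE WARD PINS `cE = Lc^{d+1}`, `cVH = −(Lc^{d+1}·½·Lc^{d+1})`, every `j`, every `cΛt cΛ`; the member is the TRANSPORTED comb
cubic slot family `V^c_j := e3OfK Lc G_j (𝒯 S̃comb_j)`, `G_j = coDressKBmAt (ctr (d+1) Lc) Lc (KInvStep Lc j)`, `𝒯 S κ u = Ψ̂ᵀ ∘ slotPsiS (ctrOff (d+1) Lc) Lc S κ u ∘ Ψ̂`, `S̃comb_j = ScombOf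
(symTablesAn1S2 d Lc cΛt) cE cVH cΛ j`; 0 `def`, 0 cited facts, 0 `def … : Prop`, 0 sorry):
§1 THE COMB CUBIC GAUGE LETTER ON THE bm CHART — `divV_e3OfK_transport_ScombOf_inl_inl` (per site: `divV V^c_j u (x,z)_{ab} = ½·E2_{j+1}(x,z)_{ab}·([z = u] − [x = u])`),
`tsum_mul_divV_e3OfK_transport_ScombOf_inl_inl` (summed against any `g`), **`tsum_grad_mul_e3OfK_transport_ScombOf_inl_inl`** (L1′: Abel-resummed, `g` of linear growth);
§2 (hsplit) **`faceSlot_e3OfK_transport_ScombOf_split(_sawtooth)`** — the face-summed slot of `V^c_j` = `Lc⁻¹×` the constant-slot sum `− (2Lc)⁻¹×E2_{j+1}·(λ(w) − λ(z))`;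
§3 the member-specific hypotheses of the generic cell-total theorem for `S := unitS s_f s_m ((cE·wE_{j+1}) • V^c_j)`: `unitS_combE3Sector_translate` (fine covariance — an2's
`e3OfK_translate` on the block-covariant `𝒯 S̃comb_j`), `faceSlot_unitS_combE3Sector_split` (hsplit), `hasSum_slotLeg_unitS_combE3Sector` (hS3, from P2 (iii); `Odd Lc`, `3 ≤ Lc`);
§4 **`comb_sum_box_current_E_eq_zero`** — (Z)_comb(j+1): `Σ_{r′∈box Lc} Σ'_{(u′,w)} 𝟙f(w_β)·vertexOfK X̃♮_{j+1} Lc S ν u′ (toSite r′) w (inl b)(inl β) = 0`;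
§5 **`comb_vhE_word_succ_eq_zero`** — K's `comb_vhE_word_succ_eq_zero_of_cellTotals` with `h0` discharged: the mixed `vh ⊗ E` word of (24)_comb at level `j+1` vanishes per bond,
UNCONDITIONALLY at the pins.  Asserts NO value of Bałaban's tables beyond an2's ∕ an1's DEFINED ones; discharges NOTHING of (C)sym ∕ (Q-D) ∕ «T2Shape» ∕ «T2Drift» ∕ (hW, hWall); the
OWNER's binder `hB0 (i ≥ 1)` still needs the E′⊗E′ pair form at levels `≥ 1` (open); NEVER «G-an2-4 closed» as (CONV-C); NOT D1, NOT `BetaPertH`, NOT continuum, NOT Clay.  2026-08-27; no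
existing file touched.
-/

noncomputable section

open Finset
open scoped BigOperators
open Literature.MathematicalPhysics.QuantumFieldTheory
open Literature.MathematicalPhysics.QuantumFieldTheory.Balaban1983to89
open Literature.MathematicalPhysics.QuantumFieldTheory.Balaban1983to89.Beta
open B12Sec2to5 (l1)
open ExpKernelCalculus (Site MKer shiftK Decays comp)
open KernelWard (divV)
open AffineAveraging (box toSite unitVec)
open AveragingContoursRooted (ctr ctrOff ctrOff_mem_box)
open OneStepResolventKernel (Fib LocStencil)
open OneStepKernelFamily (KInvStep vertexOfK)
open StepJetData (locStencil_smul)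
open BalabanStepJetsSucc (E2 wE)
open Summit.QuantumFields.BalabanUV.Beta.TameKernelCalculus (trK)
open Summit.QuantumFields.BalabanUV.Beta.AxialDressingRooted (coDressKBmAt decays_coDressKBmAt_KInvStep shiftK_coDressKBmAt_KInvStep one_le_of_neZero)
open Summit.QuantumFields.BalabanUV.Beta.HessKerDressedUnits (unitK unitS unitS_apply locStencil_unitS legScale_inl)
open Summit.QuantumFields.BalabanUV.Beta.SpineRooted (e3OfK locStencil_e3OfK e3OfK_translate)
open Summit.QuantumFields.BalabanUV.Beta.DshAn1 (hVd_iff)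
open Summit.QuantumFields.BalabanUV.Beta.SymAveragingWardRootedStencils (divV_symVhSAt_eq_conjV_ctr)
open Summit.QuantumFields.BalabanUV.Beta.SymAveragingHessianCounts (symVhSAt)
open Summit.QuantumFields.BalabanUV.Beta.SymSecondOrderTablesAn1 (symTablesAn1S2 symTablesAn1S2_V)
open Summit.QuantumFields.BalabanUV.Beta.CombChartStepJets (ScombOf SpureCombOf ScombOf_eq locStencil_ScombOf)
open Summit.QuantumFields.BalabanUV.Beta.SymCorrectorKernel (psiKS)
open Summit.QuantumFields.BalabanUV.Beta.SymCorrectorFace (slotPsiS)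
open Summit.QuantumFields.BalabanUV.Beta.CombFormSlotGaugeLetter (divV_e3OfK_SrecOf_GcombSh_inl_inl)
open Summit.QuantumFields.BalabanUV.Beta.GAN24.CombCubicStepTransport (e3OfK_GcombSh_eq_bm_transport)
open Summit.QuantumFields.BalabanUV.Beta.GAN24.CombTransportedBorder (pos_Lc)
open Summit.QuantumFields.BalabanUV.Beta.GAN24.CombVHEWordsZeroStep (exists_locStencil_transport_ScombOf transport_ScombOf_translate)
open Summit.QuantumFields.BalabanUV.Beta.GAN24.CubicGaugeLetterLinearGrowth (summable_shift_mul_locStencil tsum_grad_mul_eq_tsum_mul_divV)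
open Summit.QuantumFields.BalabanUV.Beta.GAN24.ExitFaceHalfVertexSplit (sawtooth_grad abs_sawtooth_le)
open Summit.QuantumFields.BalabanUV.Beta.GAN24.ExitFaceCurrentCellTotals (tsum_weight_current_eq_faceSlot sum_box_faceSlot_current_eq_zero)
open Summit.QuantumFields.BalabanUV.Beta.GAN24.ExitFaceCurrentCellTotalsStep (summable_abs_E2_row tsum_E2_mul_face_eq_zero sum_box_E2_face_sawtooth_eq_zero)
open Summit.QuantumFields.BalabanUV.Beta.GAN24.CombSpureSlotCharges (unitS_SpureCombOf_succ_inl_inl hasSum_slot_leg'_unitS_SpureCombOf_succ)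
open Summit.QuantumFields.BalabanUV.Beta.GAN24.CombExitFaceCurrentDivFree (comb_vhE_word_succ_eq_zero_of_cellTotals)

namespace Summit.QuantumFields.BalabanUV.Beta.GAN24.CombExitFaceCurrentCellTotals

variable {d : ℕ} {Lc : ℕ} [NeZero Lc]

/-! ## §1 The comb cubic gauge letter on the bm chart (L1 per site, summed, Abel-resummed) -/

section Letter

/-- [folklore] **THE COMB CUBIC WARD LETTER, PER SITE, ON THE bm CHART** (pins `(Lc^{d+1}, −½Lc^{2(d+1)})`, every `j`, every `cΛt cΛ`, every `d`): for the transported comb member,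
`divV V^c_j u (x,z)_{inl a, inl b} = ½·E2 d Lc (j+1) (x,z)_{ab}·([z = u] − [x = u])` — an2 g39's `divV_e3OfK_SrecOf_GcombSh_inl_inl` at an1's record ((S-V)⁰⁴ via `hVd_iff`),
re-spelled on the bm chart by M.43 `e3OfK_GcombSh_eq_bm_transport`. -/
theorem divV_e3OfK_transport_ScombOf_inl_inl (cΛt cΛ : ℝ) (j : ℕ) (u x z : Site (d + 1)) (a b : Fin (d + 1)) :
    divV (e3OfK Lc (coDressKBmAt (ctr (d + 1) Lc) Lc (KInvStep (d := d) Lc j))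
          (fun κ u => comp (comp (trK (psiKS (ctrOff (d + 1) Lc) Lc)) (slotPsiS (ctrOff (d + 1) Lc) Lc (ScombOf (symTablesAn1S2 d Lc cΛt) ((Lc : ℝ) ^ (d + 1)) (-((Lc : ℝ) ^ (d + 1) * (1 / 2) * (Lc : ℝ) ^ (d + 1))) cΛ j) κ u)) (psiKS (ctrOff (d + 1) Lc) Lc))) u x z (Sum.inl a) (Sum.inl b) =
      (1 / 2 : ℝ) * (E2 d Lc (j + 1) x z (Sum.inl a) (Sum.inl b) * ((if z = u then 1 else 0) - (if x = u then 1 else 0))) := by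
  obtain ⟨Cs, δs, hδs, hS⟩ := locStencil_ScombOf (symTablesAn1S2 d Lc cΛt) ((Lc : ℝ) ^ (d + 1)) (-((Lc : ℝ) ^ (d + 1) * (1 / 2) * (Lc : ℝ) ^ (d + 1))) cΛ j
  have hVd := (hVd_iff Lc (divV (symTablesAn1S2 d Lc cΛt).V)).2 (fun u => by
    rw [symTablesAn1S2_V]
    exact divV_symVhSAt_eq_conjV_ctr (d := d) (one_le_of_neZero Lc) u)
  have h := divV_e3OfK_SrecOf_GcombSh_inl_inl (d := d) (symTablesAn1S2 d Lc cΛt).hV (symTablesAn1S2 d Lc cΛt).hH hVd cΛ j u x z a b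
  rw [← ScombOf_eq, e3OfK_GcombSh_eq_bm_transport j hS hδs] at h
  exact h

/-- [folklore] **L1 AGAINST AN ARBITRARY GAUGE FUNCTION** (comb): `Σ'_u g u·(divV V^c_j u)(x,z)_{inl a, inl b} = ½·E2 d Lc (j+1) (x,z)_{ab}·(g z − g x)`. -/
theorem tsum_mul_divV_e3OfK_transport_ScombOf_inl_inl (cΛt cΛ : ℝ) (j : ℕ) (g : Site (d + 1) → ℝ) (x z : Site (d + 1)) (a b : Fin (d + 1)) :
    ∑' u, g u * divV (e3OfK Lc (coDressKBmAt (ctr (d + 1) Lc) Lc (KInvStep (d := d) Lc j))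
          (fun κ u => comp (comp (trK (psiKS (ctrOff (d + 1) Lc) Lc)) (slotPsiS (ctrOff (d + 1) Lc) Lc (ScombOf (symTablesAn1S2 d Lc cΛt) ((Lc : ℝ) ^ (d + 1)) (-((Lc : ℝ) ^ (d + 1) * (1 / 2) * (Lc : ℝ) ^ (d + 1))) cΛ j) κ u)) (psiKS (ctrOff (d + 1) Lc) Lc))) u x z (Sum.inl a) (Sum.inl b) =
      (1 / 2 : ℝ) * E2 d Lc (j + 1) x z (Sum.inl a) (Sum.inl b) * (g z - g x) := by
  classical
  simp only [divV_e3OfK_transport_ScombOf_inl_inl cΛt cΛ j]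
  rw [tsum_eq_sum (s := ({x, z} : Finset (Site (d + 1)))) (fun u hu => by
    have hx : x ≠ u := fun h => hu (by rw [h]; exact Finset.mem_insert_self _ _)
    have hz : z ≠ u := fun h => hu (by rw [h]; exact Finset.mem_insert_of_mem (Finset.mem_singleton_self _))
    rw [if_neg hz, if_neg hx, sub_self, mul_zero, mul_zero, mul_zero])]
  by_cases hxz : x = z
  · subst hxz
    rw [show ({x, x} : Finset (Site (d + 1))) = {x} from Finset.insert_eq_of_mem (Finset.mem_singleton_self x), Finset.sum_singleton]
    simp
  · rw [Finset.sum_pair hxz]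
    simp only [if_true, if_neg hxz, if_neg (Ne.symm hxz)]
    ring

/-- [folklore] `V^c_j` is a local stencil family at a positive rate (an2's `locStencil_e3OfK` over `exists_locStencil_transport_ScombOf`). -/
theorem exists_locStencil_e3OfK_transport_ScombOf (cΛt cE cVH cΛ : ℝ) (j : ℕ) :
    ∃ C δ : ℝ, 0 < δ ∧ LocStencil (e3OfK Lc (coDressKBmAt (ctr (d + 1) Lc) Lc (KInvStep (d := d) Lc j))
      (fun κ u => comp (comp (trK (psiKS (ctrOff (d + 1) Lc) Lc)) (slotPsiS (ctrOff (d + 1) Lc) Lc (ScombOf (symTablesAn1S2 d Lc cΛt) cE cVH cΛ j) κ u)) (psiKS (ctrOff (d + 1) Lc) Lc))) C δ := by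
  obtain ⟨CM, δM, hδM, hM⟩ := exists_locStencil_transport_ScombOf (d := d) (Lc := Lc) cΛt cE cVH cΛ j
  obtain ⟨C₁, δ₁, hδ₁, h1⟩ := locStencil_e3OfK (N := Lc) (one_le_of_neZero Lc) (decays_coDressKBmAt_KInvStep (d := d) (ctrOff_mem_box (pos_Lc (Lc := Lc))) j) hM hδM
  exact ⟨C₁, δ₁, hδ₁, h1⟩

/-- [folklore] **THE COMB CUBIC GAUGE LETTER FOR GAUGE FUNCTIONS OF LINEAR GROWTH** (Abel-resummed L1; pins, every `j`, every `d`, `|g t| ≤ A + B·|t|₁`):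
`Σ'_t Σ_κ (g(t + e_κ) − g t)·V^c_j κ t (x,z)_{inl a, inl b} = ½·E2 d Lc (j+1) (x,z)_{ab}·(g z − g x)`. -/
theorem tsum_grad_mul_e3OfK_transport_ScombOf_inl_inl (cΛt cΛ : ℝ) (j : ℕ) {g : Site (d + 1) → ℝ} {A B : ℝ} (hg : ∀ t, |g t| ≤ A + B * l1 t)
    (x z : Site (d + 1)) (a b : Fin (d + 1)) :
    ∑' t, ∑ κ, (g (t + unitVec κ) - g t) * e3OfK Lc (coDressKBmAt (ctr (d + 1) Lc) Lc (KInvStep (d := d) Lc j))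
          (fun κ u => comp (comp (trK (psiKS (ctrOff (d + 1) Lc) Lc)) (slotPsiS (ctrOff (d + 1) Lc) Lc (ScombOf (symTablesAn1S2 d Lc cΛt) ((Lc : ℝ) ^ (d + 1)) (-((Lc : ℝ) ^ (d + 1) * (1 / 2) * (Lc : ℝ) ^ (d + 1))) cΛ j) κ u)) (psiKS (ctrOff (d + 1) Lc) Lc)) κ t x z (Sum.inl a) (Sum.inl b) =
      (1 / 2 : ℝ) * E2 d Lc (j + 1) x z (Sum.inl a) (Sum.inl b) * (g z - g x) := by
  obtain ⟨C, δ, hδ, hV⟩ := exists_locStencil_e3OfK_transport_ScombOf (d := d) (Lc := Lc) cΛt ((Lc : ℝ) ^ (d + 1)) (-((Lc : ℝ) ^ (d + 1) * (1 / 2) * (Lc : ℝ) ^ (d + 1))) cΛ j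
  rw [tsum_grad_mul_eq_tsum_mul_divV hV hδ hg x z (Sum.inl a) (Sum.inl b)]
  exact tsum_mul_divV_e3OfK_transport_ScombOf_inl_inl cΛt cΛ j g x z a b

end Letter

/-! ## §2 (hsplit) The face-summed slot of the comb cubic member splits -/

section Split

/-- [folklore] **THE COMB E-SECTOR HALF-VERTEX AT THE EXIT-FACE BACKGROUND, POINTWISE IN THE LEGS** (pins, every `j`): for every `λ` of linear growth with
`λ(t + e_κ) − λ t = [κ = ν]·(1 − Lc·χ_ν(t))`, `Σ'_t χ_ν(t)·V^c_j ν t (z,s′)_{inl b, inl β} = Lc⁻¹·Σ'_t V^c_j ν t (z,s′)_{bβ} − (2Lc)⁻¹·E2 d Lc (j+1) (z,s′)_{bβ}·(λ s′ − λ z)`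
(leaf-06's `faceSlot_e3OfK_split`, member replaced). -/
theorem faceSlot_e3OfK_transport_ScombOf_split (cΛt cΛ : ℝ) (j : ℕ) (ν : Fin (d + 1)) {lam : Site (d + 1) → ℝ} {A B : ℝ}
    (hg : ∀ t, |lam t| ≤ A + B * l1 t)
    (hlam : ∀ κ t, lam (t + unitVec κ) - lam t = if κ = ν then 1 - (Lc : ℝ) * (if t ν % (Lc : ℤ) = (Lc : ℤ) - 1 then 1 else 0) else 0)
    (z s' : Site (d + 1)) (b β : Fin (d + 1)) :
    (∑' t, (if t ν % (Lc : ℤ) = (Lc : ℤ) - 1 then e3OfK Lc (coDressKBmAt (ctr (d + 1) Lc) Lc (KInvStep (d := d) Lc j))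
          (fun κ u => comp (comp (trK (psiKS (ctrOff (d + 1) Lc) Lc)) (slotPsiS (ctrOff (d + 1) Lc) Lc (ScombOf (symTablesAn1S2 d Lc cΛt) ((Lc : ℝ) ^ (d + 1)) (-((Lc : ℝ) ^ (d + 1) * (1 / 2) * (Lc : ℝ) ^ (d + 1))) cΛ j) κ u)) (psiKS (ctrOff (d + 1) Lc) Lc)) ν t z s' (Sum.inl b) (Sum.inl β) else 0)) =
      (Lc : ℝ)⁻¹ * (∑' t, e3OfK Lc (coDressKBmAt (ctr (d + 1) Lc) Lc (KInvStep (d := d) Lc j))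
          (fun κ u => comp (comp (trK (psiKS (ctrOff (d + 1) Lc) Lc)) (slotPsiS (ctrOff (d + 1) Lc) Lc (ScombOf (symTablesAn1S2 d Lc cΛt) ((Lc : ℝ) ^ (d + 1)) (-((Lc : ℝ) ^ (d + 1) * (1 / 2) * (Lc : ℝ) ^ (d + 1))) cΛ j) κ u)) (psiKS (ctrOff (d + 1) Lc) Lc)) ν t z s' (Sum.inl b) (Sum.inl β))
        - (2 * (Lc : ℝ))⁻¹ * (E2 d Lc (j + 1) z s' (Sum.inl b) (Sum.inl β) * (lam s' - lam z)) := by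
  have hL0 : (Lc : ℝ) ≠ 0 := by exact_mod_cast NeZero.ne Lc
  obtain ⟨C, δ, hδ, hV⟩ := exists_locStencil_e3OfK_transport_ScombOf (d := d) (Lc := Lc) cΛt ((Lc : ℝ) ^ (d + 1)) (-((Lc : ℝ) ^ (d + 1) * (1 / 2) * (Lc : ℝ) ^ (d + 1))) cΛ j
  set V := e3OfK Lc (coDressKBmAt (ctr (d + 1) Lc) Lc (KInvStep (d := d) Lc j))
          (fun κ u => comp (comp (trK (psiKS (ctrOff (d + 1) Lc) Lc)) (slotPsiS (ctrOff (d + 1) Lc) Lc (ScombOf (symTablesAn1S2 d Lc cΛt) ((Lc : ℝ) ^ (d + 1)) (-((Lc : ℝ) ^ (d + 1) * (1 / 2) * (Lc : ℝ) ^ (d + 1))) cΛ j) κ u)) (psiKS (ctrOff (d + 1) Lc) Lc)) with hVdef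
  -- the indicator as `Lc⁻¹(1 − dλ_ν)`
  have hχ : ∀ t : Site (d + 1), (if t ν % (Lc : ℤ) = (Lc : ℤ) - 1 then V ν t z s' (Sum.inl b) (Sum.inl β) else 0) =
      (Lc : ℝ)⁻¹ * V ν t z s' (Sum.inl b) (Sum.inl β) - (Lc : ℝ)⁻¹ * ((lam (t + unitVec ν) - lam t) * V ν t z s' (Sum.inl b) (Sum.inl β)) := by
    intro t
    rw [hlam ν t, if_pos rfl]
    split_ifs <;> field_simp <;> ring
  simp_rw [hχ]
  -- summability of the two pieces
  have h0 : Summable fun t => V ν t z s' (Sum.inl b) (Sum.inl β) := by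
    have h := summable_shift_mul_locStencil hV hδ (g := fun _ => (1 : ℝ)) (A := 1) (B := 0) (fun t => by simp) 0 ν z s' (Sum.inl b) (Sum.inl β)
    simpa using h
  have h1 : Summable fun t => (lam (t + unitVec ν) - lam t) * V ν t z s' (Sum.inl b) (Sum.inl β) := by
    have ha := summable_shift_mul_locStencil hV hδ hg (unitVec ν) ν z s' (Sum.inl b) (Sum.inl β)
    have hb := summable_shift_mul_locStencil hV hδ hg 0 ν z s' (Sum.inl b) (Sum.inl β)
    simp only [add_zero] at hb
    exact (ha.sub hb).congr fun t => by ring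
  rw [(h0.mul_left _).tsum_sub (h1.mul_left _), tsum_mul_left, tsum_mul_left]
  -- the gradient piece is the whole `κ`-sum (the other directions do not move `λ`), hence L1′
  have hκ : ∀ t : Site (d + 1), (lam (t + unitVec ν) - lam t) * V ν t z s' (Sum.inl b) (Sum.inl β) =
      ∑ κ, (lam (t + unitVec κ) - lam t) * V κ t z s' (Sum.inl b) (Sum.inl β) := by
    intro t
    rw [Finset.sum_eq_single ν (fun κ _ hκ => by rw [hlam κ t, if_neg hκ, zero_mul]) (fun h => absurd (Finset.mem_univ ν) h)]
  rw [tsum_congr hκ, hVdef, tsum_grad_mul_e3OfK_transport_ScombOf_inl_inl cΛt cΛ j hg z s' b β]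
  field_simp

/-- [folklore] **… THE SAWTOOTH INSTANCE** (`λ_ν(t) = t_ν % Lc`). -/
theorem faceSlot_e3OfK_transport_ScombOf_split_sawtooth (cΛt cΛ : ℝ) (j : ℕ) (ν : Fin (d + 1)) (z s' : Site (d + 1)) (b β : Fin (d + 1)) :
    (∑' t, (if t ν % (Lc : ℤ) = (Lc : ℤ) - 1 then e3OfK Lc (coDressKBmAt (ctr (d + 1) Lc) Lc (KInvStep (d := d) Lc j))
          (fun κ u => comp (comp (trK (psiKS (ctrOff (d + 1) Lc) Lc)) (slotPsiS (ctrOff (d + 1) Lc) Lc (ScombOf (symTablesAn1S2 d Lc cΛt) ((Lc : ℝ) ^ (d + 1)) (-((Lc : ℝ) ^ (d + 1) * (1 / 2) * (Lc : ℝ) ^ (d + 1))) cΛ j) κ u)) (psiKS (ctrOff (d + 1) Lc) Lc)) ν t z s' (Sum.inl b) (Sum.inl β) else 0)) =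
      (Lc : ℝ)⁻¹ * (∑' t, e3OfK Lc (coDressKBmAt (ctr (d + 1) Lc) Lc (KInvStep (d := d) Lc j))
          (fun κ u => comp (comp (trK (psiKS (ctrOff (d + 1) Lc) Lc)) (slotPsiS (ctrOff (d + 1) Lc) Lc (ScombOf (symTablesAn1S2 d Lc cΛt) ((Lc : ℝ) ^ (d + 1)) (-((Lc : ℝ) ^ (d + 1) * (1 / 2) * (Lc : ℝ) ^ (d + 1))) cΛ j) κ u)) (psiKS (ctrOff (d + 1) Lc) Lc)) ν t z s' (Sum.inl b) (Sum.inl β))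
        - (2 * (Lc : ℝ))⁻¹ * (E2 d Lc (j + 1) z s' (Sum.inl b) (Sum.inl β) * (((s' ν % (Lc : ℤ) : ℤ) : ℝ) - ((z ν % (Lc : ℤ) : ℤ) : ℝ))) :=
  faceSlot_e3OfK_transport_ScombOf_split cΛt cΛ j ν (abs_sawtooth_le (one_le_of_neZero Lc) ν) (fun κ t => sawtooth_grad (one_le_of_neZero Lc) ν κ t) z s' b β

end Split

/-! ## §3 The member-specific hypotheses of the generic cell-total theorem -/

section Hyps

/-- [folklore] **THE UNIT-DRESSED COMB E-SECTOR IS FINELY COVARIANT** (as a slot family of the NEXT level): `S κ (t + v) = shiftK (−v) (S κ t)` — an2's `e3OfK_translate` on the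
block-covariant `𝒯 S̃comb_j` (`transport_ScombOf_translate`) over the block-invariant `G_j` (`shiftK_coDressKBmAt_KInvStep`); any pins, any rescaling `C₀`. -/
theorem unitS_combE3Sector_translate (cΛt sf sm cE cVH cΛ C₀ : ℝ) (j : ℕ) (κ : Fin (d + 1)) (t v : Site (d + 1)) :
    unitS sf sm (fun κ t => C₀ • e3OfK Lc (coDressKBmAt (ctr (d + 1) Lc) Lc (KInvStep (d := d) Lc j))
        (fun κ u => comp (comp (trK (psiKS (ctrOff (d + 1) Lc) Lc)) (slotPsiS (ctrOff (d + 1) Lc) Lc (ScombOf (symTablesAn1S2 d Lc cΛt) cE cVH cΛ j) κ u)) (psiKS (ctrOff (d + 1) Lc) Lc)) κ t)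
        κ (t + v) =
      shiftK (-v) (unitS sf sm (fun κ t => C₀ • e3OfK Lc (coDressKBmAt (ctr (d + 1) Lc) Lc (KInvStep (d := d) Lc j))
        (fun κ u => comp (comp (trK (psiKS (ctrOff (d + 1) Lc) Lc)) (slotPsiS (ctrOff (d + 1) Lc) Lc (ScombOf (symTablesAn1S2 d Lc cΛt) cE cVH cΛ j) κ u)) (psiKS (ctrOff (d + 1) Lc) Lc)) κ t)
        κ t) := by
  have hGs : ∀ t : Site (d + 1), shiftK (-((Lc : ℤ) • t)) (coDressKBmAt (ctr (d + 1) Lc) Lc (KInvStep (d := d) Lc j))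
      = coDressKBmAt (ctr (d + 1) Lc) Lc (KInvStep (d := d) Lc j) := fun t => shiftK_coDressKBmAt_KInvStep (d := d) (ctr (d + 1) Lc) j t
  have h := e3OfK_translate (N := Lc) hGs
    (S := fun κ u => comp (comp (trK (psiKS (ctrOff (d + 1) Lc) Lc)) (slotPsiS (ctrOff (d + 1) Lc) Lc (ScombOf (symTablesAn1S2 d Lc cΛt) cE cVH cΛ j) κ u))
      (psiKS (ctrOff (d + 1) Lc) Lc))
    (fun κ u t => transport_ScombOf_translate (d := d) (Lc := Lc) cΛt cE cVH cΛ j κ u t) κ t v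
  funext x z a c
  have h' := congrFun (congrFun (congrFun (congrFun h x) z) a) c
  simp only [shiftK] at h' ⊢
  simp only [unitS_apply, Pi.smul_apply, smul_eq_mul, h']

/-- [folklore] **(hsplit) THE FACE-SUMMED SLOT OF THE UNIT-DRESSED COMB E-SECTOR SPLITS** (§2 × the leg∕sector units): with `u = (s_f s_m)⁻¹·s_f⁻¹·s_f⁻¹·(Lc^{d+1}·wE_{j+1})`,
`Σ'_t χ_ν(t)·S ν t z w (inl b)(inl β) = Lc⁻¹·Σ'_t S ν t z w (inl b)(inl β) − (2Lc)⁻¹·(u·E2_{j+1}(z,w)_{bβ}·(λ(w) − λ(z)))`. -/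
theorem faceSlot_unitS_combE3Sector_split (cΛt sf sm cΛ : ℝ) (j : ℕ) (ν : Fin (d + 1)) (z w : Site (d + 1)) (b β : Fin (d + 1)) :
    ∑' t : Site (d + 1), (if t ν % (Lc : ℤ) = (Lc : ℤ) - 1 then unitS sf sm (fun κ t => (((Lc : ℝ) ^ (d + 1)) * wE d Lc (j + 1)) • e3OfK Lc (coDressKBmAt (ctr (d + 1) Lc) Lc (KInvStep (d := d) Lc j))
            (fun κ u => comp (comp (trK (psiKS (ctrOff (d + 1) Lc) Lc)) (slotPsiS (ctrOff (d + 1) Lc) Lc (ScombOf (symTablesAn1S2 d Lc cΛt) ((Lc : ℝ) ^ (d + 1)) (-((Lc : ℝ) ^ (d + 1) * (1 / 2) * (Lc : ℝ) ^ (d + 1))) cΛ j) κ u)) (psiKS (ctrOff (d + 1) Lc) Lc)) κ t) ν t z w (Sum.inl b) (Sum.inl β) else 0) =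
      (Lc : ℝ)⁻¹ * (∑' t : Site (d + 1), unitS sf sm (fun κ t => (((Lc : ℝ) ^ (d + 1)) * wE d Lc (j + 1)) • e3OfK Lc (coDressKBmAt (ctr (d + 1) Lc) Lc (KInvStep (d := d) Lc j))
            (fun κ u => comp (comp (trK (psiKS (ctrOff (d + 1) Lc) Lc)) (slotPsiS (ctrOff (d + 1) Lc) Lc (ScombOf (symTablesAn1S2 d Lc cΛt) ((Lc : ℝ) ^ (d + 1)) (-((Lc : ℝ) ^ (d + 1) * (1 / 2) * (Lc : ℝ) ^ (d + 1))) cΛ j) κ u)) (psiKS (ctrOff (d + 1) Lc) Lc)) κ t) ν t z w (Sum.inl b) (Sum.inl β))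
        - (2 * (Lc : ℝ))⁻¹ * (((sf * sm)⁻¹ * (sf⁻¹ * sf⁻¹) * (((Lc : ℝ) ^ (d + 1)) * wE d Lc (j + 1)) * E2 d Lc (j + 1) z w (Sum.inl b) (Sum.inl β)) *
            ((((w ν % (Lc : ℤ) : ℤ) : ℝ)) - (((z ν % (Lc : ℤ) : ℤ) : ℝ)))) := by
  have h := faceSlot_e3OfK_transport_ScombOf_split_sawtooth (d := d) (Lc := Lc) cΛt cΛ j ν z w b β
  have e : ∀ t : Site (d + 1), (if t ν % (Lc : ℤ) = (Lc : ℤ) - 1 then unitS sf sm (fun κ t => (((Lc : ℝ) ^ (d + 1)) * wE d Lc (j + 1)) • e3OfK Lc (coDressKBmAt (ctr (d + 1) Lc) Lc (KInvStep (d := d) Lc j))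
            (fun κ u => comp (comp (trK (psiKS (ctrOff (d + 1) Lc) Lc)) (slotPsiS (ctrOff (d + 1) Lc) Lc (ScombOf (symTablesAn1S2 d Lc cΛt) ((Lc : ℝ) ^ (d + 1)) (-((Lc : ℝ) ^ (d + 1) * (1 / 2) * (Lc : ℝ) ^ (d + 1))) cΛ j) κ u)) (psiKS (ctrOff (d + 1) Lc) Lc)) κ t) ν t z w (Sum.inl b) (Sum.inl β) else 0) =
      ((sf * sm)⁻¹ * (sf⁻¹ * sf⁻¹) * (((Lc : ℝ) ^ (d + 1)) * wE d Lc (j + 1))) *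
        (if t ν % (Lc : ℤ) = (Lc : ℤ) - 1 then e3OfK Lc (coDressKBmAt (ctr (d + 1) Lc) Lc (KInvStep (d := d) Lc j))
          (fun κ u => comp (comp (trK (psiKS (ctrOff (d + 1) Lc) Lc)) (slotPsiS (ctrOff (d + 1) Lc) Lc (ScombOf (symTablesAn1S2 d Lc cΛt) ((Lc : ℝ) ^ (d + 1)) (-((Lc : ℝ) ^ (d + 1) * (1 / 2) * (Lc : ℝ) ^ (d + 1))) cΛ j) κ u)) (psiKS (ctrOff (d + 1) Lc) Lc)) ν t z w (Sum.inl b) (Sum.inl β) else 0) := by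
    intro t
    split_ifs
    · simp only [unitS_apply, legScale_inl, Pi.smul_apply, smul_eq_mul]; ring
    · rw [mul_zero]
  have e' : ∀ t : Site (d + 1), unitS sf sm (fun κ t => (((Lc : ℝ) ^ (d + 1)) * wE d Lc (j + 1)) • e3OfK Lc (coDressKBmAt (ctr (d + 1) Lc) Lc (KInvStep (d := d) Lc j))
            (fun κ u => comp (comp (trK (psiKS (ctrOff (d + 1) Lc) Lc)) (slotPsiS (ctrOff (d + 1) Lc) Lc (ScombOf (symTablesAn1S2 d Lc cΛt) ((Lc : ℝ) ^ (d + 1)) (-((Lc : ℝ) ^ (d + 1) * (1 / 2) * (Lc : ℝ) ^ (d + 1))) cΛ j) κ u)) (psiKS (ctrOff (d + 1) Lc) Lc)) κ t) ν t z w (Sum.inl b) (Sum.inl β) =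
      ((sf * sm)⁻¹ * (sf⁻¹ * sf⁻¹) * (((Lc : ℝ) ^ (d + 1)) * wE d Lc (j + 1))) * e3OfK Lc (coDressKBmAt (ctr (d + 1) Lc) Lc (KInvStep (d := d) Lc j))
          (fun κ u => comp (comp (trK (psiKS (ctrOff (d + 1) Lc) Lc)) (slotPsiS (ctrOff (d + 1) Lc) Lc (ScombOf (symTablesAn1S2 d Lc cΛt) ((Lc : ℝ) ^ (d + 1)) (-((Lc : ℝ) ^ (d + 1) * (1 / 2) * (Lc : ℝ) ^ (d + 1))) cΛ j) κ u)) (psiKS (ctrOff (d + 1) Lc) Lc)) ν t z w (Sum.inl b) (Sum.inl β) := by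
    intro t
    simp only [unitS_apply, legScale_inl, Pi.smul_apply, smul_eq_mul]; ring
  rw [tsum_congr e, tsum_mul_left, h, tsum_congr e', tsum_mul_left]
  ring

/-- [folklore] **(hS3) THE (SLOT + SECOND LEG) CONSTANT SUM OF THE UNIT-DRESSED COMB E-SECTOR VANISHES** at every first leg (P2's «S3C-REC» (iii) for
`unitS s_f s_m (S̃′comb_{j+1})`, whose ff block IS the E-sector's — `unitS_SpureCombOf_succ_inl_inl`; `Odd Lc`, `3 ≤ Lc`, all pins `cE cVH`, every `cΛt cΛ`). -/
theorem hasSum_slotLeg_unitS_combE3Sector (hLo : Odd Lc) (hLc : 3 ≤ Lc) (cΛt sf sm cE cVH cΛ : ℝ) (j : ℕ) (ν b β : Fin (d + 1)) (z : Site (d + 1)) :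
    HasSum (fun tw : Site (d + 1) × Site (d + 1) =>
      unitS sf sm (fun κ t => (cE * wE d Lc (j + 1)) • e3OfK Lc (coDressKBmAt (ctr (d + 1) Lc) Lc (KInvStep (d := d) Lc j))
        (fun κ u => comp (comp (trK (psiKS (ctrOff (d + 1) Lc) Lc)) (slotPsiS (ctrOff (d + 1) Lc) Lc (ScombOf (symTablesAn1S2 d Lc cΛt) cE cVH cΛ j) κ u)) (psiKS (ctrOff (d + 1) Lc) Lc)) κ t)
        ν tw.1 z tw.2 (Sum.inl b) (Sum.inl β)) 0 := by
  have h := hasSum_slot_leg'_unitS_SpureCombOf_succ (d := d) hLo hLc cΛt sf sm cE cVH cΛ j ν b β z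
  refine h.congr_fun fun tw => ?_
  exact (unitS_SpureCombOf_succ_inl_inl (d := d) (Lc := Lc) cΛt sf sm cE cVH cΛ j ν tw.1 z tw.2 b β).symm

end Hyps

/-! ## §4 (Z)_comb(j+1): the cell totals of the comb exit-face current vanish at the Ward pins -/

section CellTotals

/-- [folklore] **THE BOND-RESUMMED EXIT-FACE CURRENT OF THE TRANSPORTED COMB CUBIC SECTOR HAS ZERO CELL TOTALS** (comb root, `Odd Lc`, `3 ≤ Lc`, every `d`, every `j`, every
`cΛt cΛ`, all units, the Ward pins, every slot axis `ν`, leg axis `β`, colour `b`): `Σ_{r′ ∈ box Lc} Σ'_{(u′,w)} 𝟙f(w_β)·vertexOfK X̃♮_{j+1} Lc S ν u′ (toSite r′) w (inl b)(inl β) = 0`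
— leaf-04's generic `sum_box_faceSlot_current_eq_zero` with §3 and the member-free value-Hessian facts of `ExitFaceCurrentCellTotalsStep`. -/
theorem comb_sum_box_current_E_eq_zero (hLo : Odd Lc) (hLc : 3 ≤ Lc) (cΛt sf sm cΛ : ℝ) (j : ℕ) (ν β b : Fin (d + 1)) :
    ∑ r' ∈ box (d + 1) Lc, ∑' uw : Site (d + 1) × Site (d + 1), (if uw.2 β % (Lc : ℤ) = (Lc : ℤ) - 1 then (1 : ℝ) else 0) *
      vertexOfK (unitK sf sm (coDressKBmAt (ctr (d + 1) Lc) Lc (KInvStep (d := d) Lc (j + 1)))) Lc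
        (unitS sf sm (fun κ t => (((Lc : ℝ) ^ (d + 1)) * wE d Lc (j + 1)) • e3OfK Lc (coDressKBmAt (ctr (d + 1) Lc) Lc (KInvStep (d := d) Lc j))
            (fun κ u => comp (comp (trK (psiKS (ctrOff (d + 1) Lc) Lc)) (slotPsiS (ctrOff (d + 1) Lc) Lc (ScombOf (symTablesAn1S2 d Lc cΛt) ((Lc : ℝ) ^ (d + 1)) (-((Lc : ℝ) ^ (d + 1) * (1 / 2) * (Lc : ℝ) ^ (d + 1))) cΛ j) κ u)) (psiKS (ctrOff (d + 1) Lc) Lc)) κ t)) ν uw.1 (toSite r') uw.2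
        (Sum.inl b) (Sum.inl β) = 0 := by
  have hLc1 : 1 ≤ Lc := le_trans (by norm_num) hLc
  have hr : ctrOff (d + 1) Lc ∈ box (d + 1) Lc := ctrOff_mem_box (pos_Lc (Lc := Lc))
  obtain ⟨CE, δE, hδE, hSE⟩ := exists_locStencil_e3OfK_transport_ScombOf (d := d) (Lc := Lc) cΛt ((Lc : ℝ) ^ (d + 1)) (-((Lc : ℝ) ^ (d + 1) * (1 / 2) * (Lc : ℝ) ^ (d + 1))) cΛ j
  have hS := locStencil_unitS (sf := sf) (sm := sm) (locStencil_smul (((Lc : ℝ) ^ (d + 1)) * wE d Lc (j + 1)) hSE)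
  have hχ : ∀ w : Site (d + 1), |(if w β % (Lc : ℤ) = (Lc : ℤ) - 1 then (1 : ℝ) else 0)| ≤ 1 := fun w => by split_ifs <;> simp
  have hcur := fun z : Site (d + 1) => tsum_weight_current_eq_faceSlot (r := ctrOff (d + 1) Lc) hLc1 hr sf sm (j + 1) hS hδE hχ ν z (Sum.inl b) (Sum.inl β)
  simp only [show (toSite (ctrOff (d + 1) Lc) : Site (d + 1)) = ctr (d + 1) Lc from rfl] at hcur
  simp only [hcur]
  rw [← Finset.mul_sum]
  refine mul_eq_zero_of_right _ ?_
  have hL0 : (0 : ℤ) < (Lc : ℤ) := by exact_mod_cast Nat.pos_of_ne_zero (NeZero.ne Lc)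
  have hlam : ∀ w : Site (d + 1), |(((w ν % (Lc : ℤ) : ℤ) : ℝ))| ≤ (Lc : ℝ) := by
    intro w
    rw [abs_of_nonneg (by exact_mod_cast Int.emod_nonneg _ hL0.ne')]
    exact_mod_cast (Int.emod_lt_of_pos (w ν) hL0).le
  exact sum_box_faceSlot_current_eq_zero hS hδE (fun κ t v => unitS_combE3Sector_translate cΛt sf sm ((Lc : ℝ) ^ (d + 1)) (-((Lc : ℝ) ^ (d + 1) * (1 / 2) * (Lc : ℝ) ^ (d + 1))) cΛ (((Lc : ℝ) ^ (d + 1)) * wE d Lc (j + 1)) j κ t v) ν b β hlam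
    (fun z w => faceSlot_unitS_combE3Sector_split cΛt sf sm cΛ j ν z w b β)
    (hasSum_slotLeg_unitS_combE3Sector hLo hLc cΛt sf sm ((Lc : ℝ) ^ (d + 1)) (-((Lc : ℝ) ^ (d + 1) * (1 / 2) * (Lc : ℝ) ^ (d + 1))) cΛ j ν b β 0) (fun z => summable_abs_E2_row (Lc := Lc) (j + 1) _ z b β)
    (fun z => tsum_E2_mul_face_eq_zero (j + 1) _ z b β) (sum_box_E2_face_sawtooth_eq_zero (j + 1) _ ν b β)

end CellTotals

/-! ## §5 (24)_comb(j+1) UNCONDITIONAL at the Ward pins -/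

section Words

variable {μ ν α β : Fin (d + 1)}

/-- [folklore] **THE MIXED `vh ⊗ E` WORD OF THE COMB CONSERVATION LAW (24)_comb AT LEVEL `j+1` VANISHES PER BOND, UNCONDITIONALLY AT THE WARD PINS** (`Odd Lc`, `3 ≤ Lc`, every `d`,
every `j`, every `cΛt cΛ`, all units, any axes, any cell bond `cb`, any border weight `c`): K's `comb_vhE_word_succ_eq_zero_of_cellTotals` ((D)_comb unconditional there) with its
cell-total hypothesis `h0` discharged by §4. -/
theorem comb_vhE_word_succ_eq_zero (hLo : Odd Lc) (hLc : 3 ≤ Lc) (sf sm cΛt cΛ c : ℝ) (j : ℕ) (cb : Site (d + 1)) :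
    ∑' u' : Site (d + 1), ∑' yw : Site (d + 1) × Site (d + 1), (if yw.1 α % (Lc : ℤ) = (Lc : ℤ) - 1 then (1 : ℝ) else 0) * (if yw.2 β % (Lc : ℤ) = (Lc : ℤ) - 1 then (1 : ℝ) else 0) *
        comp (comp (vertexOfK (unitK sf sm (coDressKBmAt (ctr (d + 1) Lc) Lc (KInvStep (d := d) Lc (j + 1)))) Lc
            (unitS sf sm (fun κ v => comp (comp (trK (psiKS (ctrOff (d + 1) Lc) Lc))
              (slotPsiS (ctrOff (d + 1) Lc) Lc (fun κ v => c • symVhSAt (ctr (d + 1) Lc) d Lc rfl κ v) κ v)) (psiKS (ctrOff (d + 1) Lc) Lc))) μ cb)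
          (unitK sf sm (coDressKBmAt (ctr (d + 1) Lc) Lc (KInvStep (d := d) Lc (j + 1)))))
          (vertexOfK (unitK sf sm (coDressKBmAt (ctr (d + 1) Lc) Lc (KInvStep (d := d) Lc (j + 1)))) Lc
            (unitS sf sm (fun κ u => comp (comp (trK (psiKS (ctrOff (d + 1) Lc) Lc)) (slotPsiS (ctrOff (d + 1) Lc) Lc
              (fun κ t => (((Lc : ℝ) ^ (d + 1)) * wE d Lc (j + 1)) • e3OfK Lc (coDressKBmAt (ctr (d + 1) Lc) Lc (KInvStep (d := d) Lc j))
                (fun κ u => comp (comp (trK (psiKS (ctrOff (d + 1) Lc) Lc)) (slotPsiS (ctrOff (d + 1) Lc) Lc (ScombOf (symTablesAn1S2 d Lc cΛt) ((Lc : ℝ) ^ (d + 1)) (-((Lc : ℝ) ^ (d + 1) * (1 / 2) * (Lc : ℝ) ^ (d + 1))) cΛ j) κ u))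
                  (psiKS (ctrOff (d + 1) Lc) Lc)) κ t) κ u)) (psiKS (ctrOff (d + 1) Lc) Lc))) ν u')
          yw.1 yw.2 (Sum.inl α) (Sum.inl β) = 0 :=
  comb_vhE_word_succ_eq_zero_of_cellTotals (μ := μ) (ν := ν) (α := α) (β := β) sf sm cΛt ((Lc : ℝ) ^ (d + 1)) (-((Lc : ℝ) ^ (d + 1) * (1 / 2) * (Lc : ℝ) ^ (d + 1))) cΛ c j cb
    (fun b => comb_sum_box_current_E_eq_zero hLo hLc cΛt sf sm cΛ j ν β b)

end Words

end Summit.QuantumFields.BalabanUV.Beta.GAN24.CombExitFaceCurrentCellTotals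

end
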